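import Literature.Computability.Complexity.HardcoreInapproximabilityMWWRate
import HarnessLib

/-!
# MWW's Hessian at the product point is negative definite near the dominant phase

Clearing denominators in Mossel–Weitz–Wormald's Hessian `H_f` of the second-moment rate
(`slyQ`, file `HardcoreInapproximabilityMWWRate`) gives a polynomial matrix `N = -D·H_f`
(`slyN11 … slyN33`, `D = slyHD = α²β²(1-α)²(1-β)²(1-α-β)`), whose leading data in the order
`(ε, δ, γ)` factorise (`slyMinor2_zero`, `slyMinor3_zero`):
`det N = d α³β³(1-α)³(1-β)³(1-α-β)(1-α-β+dαβ)·[(1-α)(1-β) - (d-1)αβ]`.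
Hence `-H_f ≻ 0` iff `(d-1)αβ < (1-α)(1-β)` — Sly's (e:extraConditions) `(d-1)q⁺q⁻ < 1` at the fixed
point — and, by continuity of the minors of `N - μI`, uniformly so near `(p⁺, p⁻)`:
`slyQ_le_neg_near : ∃ χ κ > 0, |α-p⁺|,|β-p⁻| < χ → Q_{α,β}(h) ≤ -κ|h|²`.

## References
* [MosselWeitzWormald2008] E. Mossel, D. Weitz, N. Wormald, *On the hardness of sampling independent
  sets beyond the tree threshold*, PTRF 143 (2009), proof of Theorem 3.3 (the matrix `H_f`).
* [Sly2010] A. Sly, *Computational transition at the uniqueness threshold*, FOCS 2010 /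
  arXiv:1005.5584, §1.3 (e:extraConditions), §3.2.
-/

namespace Literature.Computability.Complexity

open Real Finset

section LDL

/-- **`LDLᵀ` for a symmetric `3 × 3` form**: positive pivots `a₃₃ > 0`,
`a₂₂a₃₃ - a₂₃² > 0`, `det ≥ 0` make the form nonnegative. [folklore] -/
theorem quadForm3_nonneg {a11 a12 a13 a22 a23 a33 : ℝ} (h1 : 0 < a33)
    (h2 : 0 < a22 * a33 - a23 ^ 2)
    (h3 : 0 ≤ a11 * (a22 * a33 - a23 ^ 2) - a12 * (a12 * a33 - a13 * a23) +
      a13 * (a12 * a23 - a13 * a22)) (x y z : ℝ) :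
    0 ≤ a11 * x ^ 2 + a22 * y ^ 2 + a33 * z ^ 2 + 2 * a12 * x * y + 2 * a13 * x * z +
      2 * a23 * y * z := by
  have h1' : a33 ≠ 0 := h1.ne'
  have h2' : a22 * a33 - a23 ^ 2 ≠ 0 := h2.ne'
  have key : a11 * x ^ 2 + a22 * y ^ 2 + a33 * z ^ 2 + 2 * a12 * x * y + 2 * a13 * x * z +
      2 * a23 * y * z =
      a33 * (z + (a13 * x + a23 * y) / a33) ^ 2 +
        (a22 * a33 - a23 ^ 2) / a33 * (y + (a12 * a33 - a13 * a23) / (a22 * a33 - a23 ^ 2) * x) ^ 2 +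
        (a11 * (a22 * a33 - a23 ^ 2) - a12 * (a12 * a33 - a13 * a23) +
          a13 * (a12 * a23 - a13 * a22)) / (a22 * a33 - a23 ^ 2) * x ^ 2 := by
    field_simp
    ring
  rw [key]
  have t1 : 0 ≤ a33 * (z + (a13 * x + a23 * y) / a33) ^ 2 := mul_nonneg h1.le (sq_nonneg _)
  have t2 : 0 ≤ (a22 * a33 - a23 ^ 2) / a33 *
      (y + (a12 * a33 - a13 * a23) / (a22 * a33 - a23 ^ 2) * x) ^ 2 :=
    mul_nonneg (div_nonneg h2.le h1.le) (sq_nonneg _)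
  have t3 : 0 ≤ (a11 * (a22 * a33 - a23 ^ 2) - a12 * (a12 * a33 - a13 * a23) +
      a13 * (a12 * a23 - a13 * a22)) / (a22 * a33 - a23 ^ 2) * x ^ 2 :=
    mul_nonneg (div_nonneg h3 h2.le) (sq_nonneg _)
  linarith

end LDL

section Nmatrix

variable (d : ℕ) (α β : ℝ)

/-- The common denominator `D = α²β²(1-α)²(1-β)²(1-α-β)` of MWW's Hessian `H_f`. [cite: MosselWeitzWormald2008, proof of Theorem 3.3] -/
noncomputable def slyHD : ℝ := α ^ 2 * β ^ 2 * (1 - α) ^ 2 * (1 - β) ^ 2 * (1 - α - β)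

/-- Entry `(γ,γ)` of the polynomial matrix `N = -D · H_f`. [cite: MosselWeitzWormald2008, proof of Theorem 3.3] -/
noncomputable def slyN11 : ℝ :=
  -((α + d - 2) * (α * β ^ 2 * (1 - β) ^ 2 * (1 - α - β)) -
      (β + d * α) * (β * (1 - α) ^ 2 * (1 - β) ^ 2 * (1 - α - β)) +
      d * (α ^ 2 * β ^ 2 * (1 - α) * (1 - β) * (1 - α - β)) - d * (α ^ 2 * β * (1 - α) ^ 2 * (1 - β)))

/-- Entries `(γ,δ) = (δ,ε)` of `N = -D · H_f`. [cite: MosselWeitzWormald2008, proof of Theorem 3.3] -/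
noncomputable def slyN12 : ℝ := -(d * α ^ 2 * β * (1 - α) ^ 2 * (1 - β))

/-- Entry `(γ,ε)` of `N = -D · H_f`. [cite: MosselWeitzWormald2008, proof of Theorem 3.3] -/
noncomputable def slyN13 : ℝ := d * α * β * (1 - α) * (1 - β) * (1 - α - 2 * β + 2 * α * β + β ^ 2)

/-- Entry `(δ,δ)` of `N = -D · H_f`. [cite: MosselWeitzWormald2008, proof of Theorem 3.3] -/
noncomputable def slyN22 : ℝ := α ^ 2 * (1 - α) ^ 2 * (1 - α - β + d * α * β)

/-- Entry `(ε,ε)` of `N = -D · H_f`. [cite: MosselWeitzWormald2008, proof of Theorem 3.3] -/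
noncomputable def slyN33 : ℝ := d * α * β * (1 - α) * (1 - β) * (1 - α - β + 2 * α * β)

/-- The quadratic form `hᵀ (N - μ I) h`. [folklore] -/
noncomputable def slyNform (μ h₁ h₂ h₃ : ℝ) : ℝ :=
  (slyN11 d α β - μ) * h₁ ^ 2 + (slyN22 d α β - μ) * h₂ ^ 2 + (slyN33 d α β - μ) * h₃ ^ 2 +
    2 * slyN12 d α β * h₁ * h₂ + 2 * slyN13 d α β * h₁ * h₃ + 2 * slyN12 d α β * h₂ * h₃

/-- Second leading data of `N - μI` in the order `(ε, δ, γ)`: the `(δ,ε)` minor. [folklore] -/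
noncomputable def slyMinor2 (μ : ℝ) : ℝ :=
  (slyN22 d α β - μ) * (slyN33 d α β - μ) - slyN12 d α β ^ 2

/-- The determinant of `N - μI` (expanded along the `γ` row). [folklore] -/
noncomputable def slyMinor3 (μ : ℝ) : ℝ :=
  (slyN11 d α β - μ) * slyMinor2 d α β μ -
      slyN12 d α β * (slyN12 d α β * (slyN33 d α β - μ) - slyN13 d α β * slyN12 d α β) +
    slyN13 d α β * (slyN12 d α β * slyN12 d α β - slyN13 d α β * (slyN22 d α β - μ))

end Nmatrix

set_option maxHeartbeats 4000000 in
/-- `D · (-2 Q(h)) = hᵀ N h`: clearing the denominators of MWW's Hessian form. [cite: MosselWeitzWormald2008, proof of Theorem 3.3] -/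
theorem slyHD_mul_slyQ (d : ℕ) {α β : ℝ} (hα : 0 < α) (hβ : 0 < β) (hαβ : α + β < 1)
    (h₁ h₂ h₃ : ℝ) :
    slyHD α β * (-2 * slyQ d α β h₁ h₂ h₃) = slyNform d α β 0 h₁ h₂ h₃ := by
  have h1 : (1 - α) ≠ 0 := by intro h; linarith
  have h1' : (α - 1) ≠ 0 := by intro h; linarith
  have h2 : (1 - β) ≠ 0 := by intro h; linarith
  have h3 : (1 - α - β) ≠ 0 := by intro h; linarith
  have hα' : α ≠ 0 := hα.ne'
  have hβ' : β ≠ 0 := hβ.ne'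
  unfold slyHD slyQ slyNform slyN11 slyN12 slyN13 slyN22 slyN33
  field_simp
  ring

/-- The `(δ,ε)` minor of `N` factorises: `N₂₂N₃₃ - N₂₃² = d α³β(1-α)³(1-β)[(1-α)²(1-β)² + (d-1)α²β²]`. [folklore] -/
theorem slyMinor2_zero (d : ℕ) (α β : ℝ) :
    slyMinor2 d α β 0 =
      d * α ^ 3 * β * (1 - α) ^ 3 * (1 - β) * ((1 - α) ^ 2 * (1 - β) ^ 2 + (d - 1) * α ^ 2 * β ^ 2) := by
  unfold slyMinor2 slyN22 slyN33 slyN12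
  ring

/-- **The determinant of MWW's Hessian** (cleared of denominators):
`det N = d α³β³(1-α)³(1-β)³(1-α-β)(1-α-β+dαβ)[(1-α)(1-β) - (d-1)αβ]`, so `-H_f ≻ 0` exactly when
`(d-1)αβ < (1-α)(1-β)` (given `α+β<1`), i.e. Sly's (e:extraConditions) `(d-1)q⁺q⁻ < 1` at the
fixed point (`q⁺q⁻ = αβ/((1-α)(1-β))`). [cite: MosselWeitzWormald2008, proof of Theorem 3.3 (the matrix `H_f`); Sly2010, §1.3 (e:extraConditions)] -/
theorem slyMinor3_zero (d : ℕ) (α β : ℝ) :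
    slyMinor3 d α β 0 =
      d * α ^ 3 * β ^ 3 * (1 - α) ^ 3 * (1 - β) ^ 3 * (1 - α - β) * (1 - α - β + d * α * β) *
        ((1 - α) * (1 - β) - (d - 1) * α * β) := by
  unfold slyMinor3 slyMinor2 slyN11 slyN22 slyN33 slyN12 slyN13
  ring

section PosDef

open Filter Topology

/-- Continuity of the three leading data of `N - μI` in `(α, β, μ)`. [folklore] -/
theorem continuous_slyMinors (d : ℕ) :
    Continuous (fun p : ℝ × ℝ × ℝ => slyN33 d p.1 p.2.1 - p.2.2) ∧
      Continuous (fun p : ℝ × ℝ × ℝ => slyMinor2 d p.1 p.2.1 p.2.2) ∧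
        Continuous (fun p : ℝ × ℝ × ℝ => slyMinor3 d p.1 p.2.1 p.2.2) := by
  unfold slyMinor3 slyMinor2 slyN11 slyN22 slyN33 slyN12 slyN13
  refine ⟨by fun_prop, by fun_prop, by fun_prop⟩

/-- `hᵀ(N - μI)h = hᵀNh - μ|h|²`. [folklore] -/
theorem slyNform_sub (d : ℕ) (α β μ h₁ h₂ h₃ : ℝ) :
    slyNform d α β μ h₁ h₂ h₃ = slyNform d α β 0 h₁ h₂ h₃ - μ * (h₁ ^ 2 + h₂ ^ 2 + h₃ ^ 2) := by
  unfold slyNform; ring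

/-- Positive minors of `N - μI` make `hᵀ N h ≥ μ |h|²`. [folklore] -/
theorem slyNform_ge_of_minors (d : ℕ) {α β μ : ℝ} (h1 : 0 < slyN33 d α β - μ)
    (h2 : 0 < slyMinor2 d α β μ) (h3 : 0 ≤ slyMinor3 d α β μ) (h₁ h₂ h₃ : ℝ) :
    μ * (h₁ ^ 2 + h₂ ^ 2 + h₃ ^ 2) ≤ slyNform d α β 0 h₁ h₂ h₃ := by
  have key := quadForm3_nonneg (a11 := slyN11 d α β - μ) (a12 := slyN12 d α β)
    (a13 := slyN13 d α β) (a22 := slyN22 d α β - μ) (a23 := slyN12 d α β)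
    (a33 := slyN33 d α β - μ) h1 h2 (by unfold slyMinor3 slyMinor2 at h3; linarith) h₁ h₂ h₃
  have key' : 0 ≤ slyNform d α β μ h₁ h₂ h₃ := key
  rw [slyNform_sub] at key'
  linarith

/-- **`-H_f ≻ 0` uniformly near the dominant phase**: if `(d-1) p⁺p⁻ < (1-p⁺)(1-p⁻)` then for
`(α, β)` close to `(p⁺, p⁻)` the cleared Hessian form dominates `μ|h|²`.
[cite: MosselWeitzWormald2008, proof of Theorem 3.3; Sly2010, §1.3 (e:extraConditions), §3.2] -/
theorem slyNform_posDef_near (d : ℕ) (hd : 1 ≤ d) {pp pm : ℝ} (hpp : 0 < pp) (hpm : 0 < pm)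
    (hsum : pp + pm < 1) (hρ : ((d : ℝ) - 1) * pp * pm < (1 - pp) * (1 - pm)) :
    ∃ χ : ℝ, 0 < χ ∧ ∃ μ : ℝ, 0 < μ ∧ ∀ α β : ℝ, |α - pp| < χ → |β - pm| < χ →
      ∀ h₁ h₂ h₃ : ℝ, μ * (h₁ ^ 2 + h₂ ^ 2 + h₃ ^ 2) ≤ slyNform d α β 0 h₁ h₂ h₃ := by
  obtain ⟨c1, c2, c3⟩ := continuous_slyMinors d
  have hdR : (1 : ℝ) ≤ d := by exact_mod_cast hd
  have h1p : 0 < 1 - pp := by linarith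
  have h1m : 0 < 1 - pm := by linarith
  have hab : 0 < 1 - pp - pm := by linarith
  set x₀ : ℝ × ℝ × ℝ := (pp, pm, 0) with hx₀
  -- the three values at `x₀`
  have v1 : 0 < slyN33 d pp pm - 0 := by
    rw [sub_zero]; unfold slyN33
    have : 0 < 1 - pp - pm + 2 * pp * pm := by positivity
    have h5 : 0 < (d : ℝ) * pp * pm * (1 - pp) * (1 - pm) := by positivity
    positivity
  have v2 : 0 < slyMinor2 d pp pm 0 := by
    rw [slyMinor2_zero]
    have : 0 < (1 - pp) ^ 2 * (1 - pm) ^ 2 + ((d : ℝ) - 1) * pp ^ 2 * pm ^ 2 := by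
      have : 0 ≤ ((d : ℝ) - 1) * pp ^ 2 * pm ^ 2 := by
        have : (0 : ℝ) ≤ (d : ℝ) - 1 := by linarith
        positivity
      positivity
    positivity
  have v3 : 0 < slyMinor3 d pp pm 0 := by
    rw [slyMinor3_zero]
    have e1 : 0 < (1 - pp) * (1 - pm) - ((d : ℝ) - 1) * pp * pm := by linarith
    have e2 : 0 < 1 - pp - pm + (d : ℝ) * pp * pm := by positivity
    positivity
  have ev1 : ∀ᶠ p in 𝓝 x₀, 0 < slyN33 d p.1 p.2.1 - p.2.2 :=
    c1.continuousAt.eventually (lt_mem_nhds (by simpa [hx₀] using v1))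
  have ev2 : ∀ᶠ p in 𝓝 x₀, 0 < slyMinor2 d p.1 p.2.1 p.2.2 :=
    c2.continuousAt.eventually (lt_mem_nhds (by simpa [hx₀] using v2))
  have ev3 : ∀ᶠ p in 𝓝 x₀, 0 < slyMinor3 d p.1 p.2.1 p.2.2 :=
    c3.continuousAt.eventually (lt_mem_nhds (by simpa [hx₀] using v3))
  obtain ⟨ε, hε, hball⟩ := Metric.eventually_nhds_iff.mp (ev1.and (ev2.and ev3))
  refine ⟨ε / 2, by positivity, ε / 2, by positivity, ?_⟩
  intro α β hα hβ h₁ h₂ h₃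
  have hdist : dist ((α, β, ε / 2) : ℝ × ℝ × ℝ) x₀ < ε := by
    rw [hx₀]
    simp only [Prod.dist_eq, Real.dist_eq, sub_zero]
    refine max_lt (lt_trans hα (half_lt_self hε)) (max_lt (lt_trans hβ (half_lt_self hε)) ?_)
    rw [abs_of_pos (by positivity)]; linarith
  obtain ⟨m1, m2, m3⟩ := hball hdist
  exact slyNform_ge_of_minors d m1 m2 m3.le h₁ h₂ h₃

/-- `0 < D ≤ 1` on the open simplex. [folklore] -/
theorem slyHD_pos_le_one {α β : ℝ} (hα : 0 < α) (hβ : 0 < β) (hαβ : α + β < 1) :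
    0 < slyHD α β ∧ slyHD α β ≤ 1 := by
  unfold slyHD
  have h1 : 0 < 1 - α := by linarith
  have h2 : 0 < 1 - β := by linarith
  have h3 : 0 < 1 - α - β := by linarith
  refine ⟨by positivity, ?_⟩
  have a1 : α ^ 2 ≤ 1 := pow_le_one₀ hα.le (by linarith)
  have a2 : β ^ 2 ≤ 1 := pow_le_one₀ hβ.le (by linarith)
  have a3 : (1 - α) ^ 2 ≤ 1 := pow_le_one₀ h1.le (by linarith)
  have a4 : (1 - β) ^ 2 ≤ 1 := pow_le_one₀ h2.le (by linarith)
  have a5 : (1 - α - β) ≤ 1 := by linarith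
  exact mul_le_one₀ (mul_le_one₀ (mul_le_one₀ (mul_le_one₀ a1 (by positivity) a2)
    (by positivity) a3) (by positivity) a4) h3.le a5

/-- **MWW's Hessian is uniformly negative definite near the dominant phase**: there are
`χ, κ > 0` with `Q_{α,β}(h) ≤ -κ|h|²` whenever `|α-p⁺|, |β-p⁻| < χ`.
[cite: MosselWeitzWormald2008, proof of Theorem 3.3; Sly2010, §3.2 (proof of Lemma 3.5)] -/
theorem slyQ_le_neg_near (d : ℕ) (hd : 1 ≤ d) {pp pm : ℝ} (hpp : 0 < pp) (hpm : 0 < pm)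
    (hsum : pp + pm < 1) (hρ : ((d : ℝ) - 1) * pp * pm < (1 - pp) * (1 - pm)) :
    ∃ χ : ℝ, 0 < χ ∧ ∃ κ : ℝ, 0 < κ ∧ ∀ α β : ℝ, |α - pp| < χ → |β - pm| < χ →
      (0 < α ∧ 0 < β ∧ α + β < 1) ∧
      ∀ h₁ h₂ h₃ : ℝ, slyQ d α β h₁ h₂ h₃ ≤ -κ * (h₁ ^ 2 + h₂ ^ 2 + h₃ ^ 2) := by
  obtain ⟨χ, hχ, μ, hμ, H⟩ := slyNform_posDef_near d hd hpp hpm hsum hρ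
  have hab : 0 < 1 - pp - pm := by linarith
  set m₀ : ℝ := min pp (min pm (1 - pp - pm)) with hm₀
  have hm₀p : 0 < m₀ := lt_min hpp (lt_min hpm hab)
  have hm₁ : m₀ ≤ pp := min_le_left _ _
  have hm₂ : m₀ ≤ pm := le_trans (min_le_right _ _) (min_le_left _ _)
  have hm₃ : m₀ ≤ 1 - pp - pm := le_trans (min_le_right _ _) (min_le_right _ _)
  refine ⟨min χ (m₀ / 4), lt_min hχ (by positivity), μ / 2, by positivity, ?_⟩
  intro α β hα hβ
  have hα' : |α - pp| < χ := lt_of_lt_of_le hα (min_le_left _ _)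
  have hβ' : |β - pm| < χ := lt_of_lt_of_le hβ (min_le_left _ _)
  have hα4 : |α - pp| < m₀ / 4 := lt_of_lt_of_le hα (min_le_right _ _)
  have hβ4 : |β - pm| < m₀ / 4 := lt_of_lt_of_le hβ (min_le_right _ _)
  rw [abs_lt] at hα4 hβ4
  have hαp : 0 < α := by linarith [hα4.1]
  have hβp : 0 < β := by linarith [hβ4.1]
  have hs : α + β < 1 := by linarith [hα4.2, hβ4.2]
  refine ⟨⟨hαp, hβp, hs⟩, ?_⟩
  intro h₁ h₂ h₃
  have key := H α β hα' hβ' h₁ h₂ h₃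
  rw [← slyHD_mul_slyQ d hαp hβp hs] at key
  obtain ⟨hD0, hD1⟩ := slyHD_pos_le_one hαp hβp hs
  have hsq : 0 ≤ h₁ ^ 2 + h₂ ^ 2 + h₃ ^ 2 := by positivity
  -- `μ S ≤ D (-2Q)` and `D ≤ 1`, `Q ≤ 0`-direction
  have hQ : slyHD α β * (2 * slyQ d α β h₁ h₂ h₃) ≤ -(μ * (h₁ ^ 2 + h₂ ^ 2 + h₃ ^ 2)) := by
    linarith
  nlinarith [mul_le_mul_of_nonneg_left hD1 (mul_nonneg hμ.le hsq), hQ, hD0]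

end PosDef

end Literature.Computability.Complexity
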